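import Literature.AlgebraicGeometry.Motives.UniversalHypersurfaceFibre
import Literature.FieldTheory.AlgClosed.AutStableSetAlgebraicPoint
import HarnessLib

/-!
# Points with algebraic coefficients on `ℚ̄`-closed subsets of the parameter space of smooth hypersurfaces

Family `hodge`, layer `Literature/AlgebraicGeometry/Motives`; theorems only (no definition, no named
fact). Companion of `UniversalHypersurfaceFamily` / `UniversalHypersurfaceFibre` (the universal family
`π : 𝒴_U → U` of smooth hypersurfaces of degree `d` in `ℙⁿ⁺¹`, `U = base k n d` the Zariski open set of
nonsingular forms inside the affine space `S^d` of forms, a `K`-point `t ∈ U(K)` having the coefficient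
homomorphism `pointHom t : k[a_m] → K` and the form `pointForm t = Σ_m t(a_m) x^m`).

Voisin (*Hodge loci and absolute Hodge classes*, Compos. Math. 143 (2007), Lemma 1.4 and §3) runs the
fields-of-definition argument for Hodge loci on a family defined over `ℚ`: an algebraic subset of the
base which is stable under `Aut(ℂ/ℚ̄)` acting on the coefficients is defined over `ℚ̄`, hence has a
`ℚ̄`-point. This file proves that statement on the tree's carrier `U(ℂ) = ComplexPoints (base ℂ n d)`:

* §1 (coefficient vectors, any field `k`): the coefficient homomorphism of a `k`-point `t ∈ U(k)` is
  evaluation at its coefficient vector `m ↦ t(a_m)` (`pointHom_hom_eq_eval`); the underlying point of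
  `S^d = Spec k[a_m]` is the kernel of that evaluation (`ι_base_pt_eq_comap`), so that `t` lies over a
  Zariski closed `V(S) ⊆ S^d` iff every member of `S` vanishes at the coefficient vector
  (`ι_base_pt_mem_zeroLocus_iff`); conversely every vector whose evaluation point lies in `U` is the
  coefficient vector of a point of `U(k)` (`exists_point_of_comap_eval_mem_baseOpens`, the lift through
  the open immersion `U ⊆ S^d`, as in `pointOfForm`).
* §2 (`k = ℂ`): **a non-empty subset `Z ⊆ U(ℂ)` which is Zariski closed on points and stable under every
  automorphism of `ℂ` fixing the algebraic numbers (acting through the coefficients,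
  `t ↦ [τ(F_t)] = pointOfForm (τ F_t)`) contains a point whose form has all its coefficients algebraic
  over `ℚ`** (`exists_mem_forall_isAlgebraic_coeff_pointForm`). Proof: in coefficient coordinates `Z`
  is the locally closed set `V(I) ∖ V(𝔡) ⊆ ℂ^{#monomials}` (`𝔡` cutting out the discriminant
  `S^d ∖ U`), both pieces are `Aut(ℂ/ℚ̄)`-stable, and Weil–Lang descent of `ℚ̄`-closed sets with the
  Nullstellensatz over `ℚ̄` (`FieldTheory/AlgClosed/AutStableSetAlgebraicPoint`,
  `Complex.exists_algebraic_point_of_forall_ringEquiv`) gives the algebraic point.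

Consumer: route `FiniteTreeOfFlavours` of `HodgeConjecture` (crux `RigidImpliesQbar`, stub
`stub_qbarClosed_has_algebraic_point`: "a non-empty `ℚ̄`-closed subset of `U(ℂ)` contains a point with
algebraic coefficients").

## References

* [Voisin2007HodgeLoci] C. Voisin, Hodge loci and absolute Hodge classes, Compos. Math. 143 (2007),
  945–958, Lemma 1.4 and §3.
* [Lang1958IAG] S. Lang, Introduction to Algebraic Geometry (1958), Ch. III §5, C4–C7.
* [VoisinHodgeII2003] C. Voisin, Hodge Theory and Complex Algebraic Geometry II (2003), §6.2.1.
-/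

noncomputable section

open CategoryTheory AlgebraicGeometry MvPolynomial

universe u

namespace Literature.AlgebraicGeometry.Motives.UniversalHypersurface

/-! ### §1 Coefficient vectors of points of `U` -/

section CoeffVector

variable (k : Type u) [Field k] (n d : ℕ)

/-- **The coefficient homomorphism of a `k`-point of `U` is evaluation at its coefficient vector**
`m ↦ t(a_m)` (it is a `k`-algebra map, `pointHom_comp_algebraMap`). [folklore] -/
private theorem pointHom_hom_eq_eval (t : AlgPoints (base k n d) k) :
    (pointHom k n d t).hom = eval (fun m => (pointHom k n d t).hom (X m)) := by
  refine MvPolynomial.ringHom_ext (fun r => ?_) (fun m => ?_)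
  · have h := congrArg (fun φ : k →+* k => φ r) (pointHom_comp_algebraMap k n d t)
    simp only [RingHom.comp_apply, Algebra.algebraMap_self, RingHom.id_apply] at h
    rw [MvPolynomial.algebraMap_eq] at h
    rw [h, eval_C]
  · rw [eval_X]

/-- **The point of `S^d = Spec k[a_m]` under a `k`-point `t` of `U`** is the contraction of the closed
point of `Spec k` along the coefficient homomorphism, i.e. the kernel of `pointHom t`
(`Spec_map_pointHom`). [folklore] -/
private theorem ι_base_pt_eq_comap (t : AlgPoints (base k n d) k) :
    (baseOpens k n d).ι.base t.pt =
      PrimeSpectrum.comap (pointHom k n d t).hom (IsLocalRing.closedPoint k) := by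
  show (t.left ≫ (baseOpens k n d).ι).base (IsLocalRing.closedPoint k) = _
  rw [← Spec_map_pointHom]
  rfl

/-- For a ring homomorphism `φ : R → k` to a field, the contraction of the closed point lies on
`V(S)` iff `φ` kills `S`. [folklore] -/
private theorem comap_closedPoint_mem_zeroLocus_iff {R : Type u} [CommRing R] (φ : R →+* k) (S : Set R) :
    PrimeSpectrum.comap φ (IsLocalRing.closedPoint k) ∈ PrimeSpectrum.zeroLocus S ↔
      ∀ F ∈ S, φ F = 0 := by
  rw [PrimeSpectrum.mem_zeroLocus]
  refine forall₂_congr fun F _ => ?_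
  change φ F ∈ IsLocalRing.maximalIdeal k ↔ _
  rw [IsLocalRing.mem_maximalIdeal, mem_nonunits_iff, isUnit_iff_ne_zero, not_not]

/-- **A `k`-point `t ∈ U(k)` lies over the Zariski closed set `V(S) ⊆ S^d` iff every member of `S`
is killed by its coefficient homomorphism (= vanishes at its coefficient vector,
`pointHom_hom_eq_eval`).** [folklore] -/
private theorem ι_base_pt_mem_zeroLocus_iff (t : AlgPoints (base k n d) k) (S : Set (CoeffRing k n d)) :
    (baseOpens k n d).ι.base t.pt ∈ PrimeSpectrum.zeroLocus S ↔
      ∀ F ∈ S, (pointHom k n d t).hom F = 0 := by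
  rw [ι_base_pt_eq_comap]
  exact comap_closedPoint_mem_zeroLocus_iff k (pointHom k n d t).hom S

/-- The point of `S^d` under a point of `U` lies in `U` (`Scheme.Opens.range_ι`). [folklore] -/
private theorem ι_base_pt_mem_baseOpens (t : AlgPoints (base k n d) k) :
    (baseOpens k n d).ι.base t.pt ∈ (baseOpens k n d : Set (Spec (.of (CoeffRing k n d)))) := by
  rw [← Scheme.Opens.range_ι]
  exact ⟨t.pt, rfl⟩

/-- **Every vector whose evaluation point lies in `U` is the coefficient vector of a point of `U(k)`**:
if the kernel of `ev_c : k[a_m] → k` lies in the open set `U` of nonsingular forms, the morphism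
`Spec k → S^d` it defines lifts through the open immersion `U ⊆ S^d` (Mathlib `IsOpenImmersion.lift`)
to a `k`-point `t` with `pointHom t = ev_c`. [folklore] -/
private theorem exists_point_of_comap_eval_mem_baseOpens (c : DegIndex n d → k)
    (hc : PrimeSpectrum.comap (eval c) (IsLocalRing.closedPoint k) ∈
      (baseOpens k n d : Set (Spec (.of (CoeffRing k n d))))) :
    ∃ t : AlgPoints (base k n d) k, (pointHom k n d t).hom = eval c := by
  set f : Spec (.of k) ⟶ Spec (.of (CoeffRing k n d)) := Spec.map (CommRingCat.ofHom (eval c))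
    with hf
  have hrange : Set.range f.base ⊆ Set.range (baseOpens k n d).ι.base := by
    rw [Scheme.Opens.range_ι]
    rintro _ ⟨y, rfl⟩
    obtain rfl : y = IsLocalRing.closedPoint k := Subsingleton.elim _ _
    exact hc
  let g : Spec (.of k) ⟶ (baseOpens k n d).toScheme :=
    IsOpenImmersion.lift (baseOpens k n d).ι f hrange
  have hg : g ≫ (baseOpens k n d).ι = f := IsOpenImmersion.lift_fac _ _ _
  have hcomp : (eval c).comp (algebraMap k (CoeffRing k n d)) = algebraMap k k := by
    ext r
    simp [MvPolynomial.algebraMap_eq]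
  have hw : g ≫ (base k n d).hom = Spec.map (CommRingCat.ofHom (algebraMap k k)) := by
    change (g ≫ (baseOpens k n d).ι) ≫ specCoeffToSpec k n d = _
    rw [hg, hf, ← Spec.map_comp, ← CommRingCat.ofHom_comp, hcomp]
  refine ⟨AlgPoints.mk (X := base k n d) g hw, ?_⟩
  have h : pointHom k n d (AlgPoints.mk (X := base k n d) g hw) = CommRingCat.ofHom (eval c) := by
    apply Spec.map_injective
    rw [Spec_map_pointHom]
    exact hg
  rw [h, CommRingCat.hom_ofHom]

/-- **The coefficient vector of the conjugate point `[τ(F_t)]`** is `τ ∘ (coefficient vector of t)`: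
for a ring endomorphism `τ` of `k`, the point of the (homogeneous, nonsingular) form `τ(F_t)` has
coefficient homomorphism `a_m ↦ τ(t(a_m))` (`pointForm_pointOfForm`, `coeff_map`). [folklore] -/
private theorem pointHom_pointOfForm_map_apply_X (τ : k →+* k) (t : AlgPoints (base k n d) k)
    (m : DegIndex n d) :
    (pointHom k n d (pointOfForm k n d ((isHomogeneous_pointForm k n d t).map τ)
      ((isNonsingularForm_pointForm k n d t).map τ))).hom (X m) =
      τ ((pointHom k n d t).hom (X m)) := by
  rw [← coeff_pointForm, pointForm_pointOfForm, coeff_map, coeff_pointForm]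

end CoeffVector

/-! ### §2 `ℚ̄`-closed subsets of `U(ℂ)` have points with algebraic coefficients -/

section Complex

variable (n d : ℕ)

/-- **A non-empty `ℚ̄`-closed subset of `U(ℂ)` contains a point with algebraic coefficients** (Voisin
2007, Lemma 1.4 / Lang III §5 for the base of the universal family of hypersurfaces, which is defined
over `ℚ`). Let `Z ⊆ U(ℂ)` be non-empty, Zariski closed on points, and stable under `t ↦ [τ(F_t)]` for
every automorphism `τ` of `ℂ` fixing every algebraic number. Then some `t ∈ Z` has a form `F_t` all of
whose coefficients are algebraic over `ℚ`. [cite: Voisin2007HodgeLoci, Lemma 1.4]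
[cite: Lang1958IAG, Ch. III §5, C4–C7] -/
theorem exists_mem_forall_isAlgebraic_coeff_pointForm (Z : Set (AlgPoints (base ℂ n d) ℂ))
    (hne : Z.Nonempty) (hZ : IsZariskiClosedOnPoints (base ℂ n d) Z)
    (hstab : ∀ τ : ℂ ≃+* ℂ, (∀ z : ℂ, IsAlgebraic ℚ z → τ z = z) → ∀ t ∈ Z,
      pointOfForm ℂ n d ((isHomogeneous_pointForm ℂ n d t).map (τ : ℂ →+* ℂ))
        ((isNonsingularForm_pointForm ℂ n d t).map (τ : ℂ →+* ℂ)) ∈ Z) :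
    ∃ t ∈ Z, ∀ m, IsAlgebraic ℚ ((pointForm ℂ n d t).coeff m) := by
  classical
  -- coefficient vectors and evaluation
  let cv : AlgPoints (base ℂ n d) ℂ → (DegIndex n d → ℂ) := fun t m => (pointHom ℂ n d t).hom (X m)
  have hev : ∀ (t : AlgPoints (base ℂ n d) ℂ) (F : CoeffRing ℂ n d),
      (pointHom ℂ n d t).hom F = eval (cv t) F := fun t F =>
    congrArg (fun φ : CoeffRing ℂ n d →+* ℂ => φ F) (pointHom_hom_eq_eval ℂ n d t)
  -- `Z = {t | t.pt ∈ Zc}`, `Zc = ι⁻¹(V(S))`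
  obtain ⟨Zc, hZc, rfl⟩ := hZ
  have hind : Topology.IsInducing (baseOpens ℂ n d).ι.base :=
    (baseOpens ℂ n d).ι.isOpenEmbedding.isInducing
  obtain ⟨Cl, hCl, hZcCl⟩ := hind.isClosed_iff.mp hZc
  obtain ⟨S, rfl⟩ := (PrimeSpectrum.isClosed_iff_zeroLocus Cl).mp hCl
  -- the discriminant `S^d ∖ U = V(S')`
  obtain ⟨S', hS'⟩ := (PrimeSpectrum.isClosed_iff_zeroLocus _).mp
    (baseOpens ℂ n d).isOpen.isClosed_compl
  -- membership in `Z` and in the discriminant, in coefficient coordinates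
  have hmemZ : ∀ t : AlgPoints (base ℂ n d) ℂ,
      t ∈ {P : AlgPoints (base ℂ n d) ℂ | P.pt ∈ Zc} ↔ ∀ F ∈ S, eval (cv t) F = 0 := fun t => by
    have h1 : t ∈ {P : AlgPoints (base ℂ n d) ℂ | P.pt ∈ Zc} ↔
        (baseOpens ℂ n d).ι.base t.pt ∈ PrimeSpectrum.zeroLocus S := by
      rw [← hZcCl]
      rfl
    rw [h1, ι_base_pt_mem_zeroLocus_iff]
    exact forall₂_congr fun F _ => by rw [hev t F]
  have hnotD : ∀ t : AlgPoints (base ℂ n d) ℂ, ¬ ∀ F ∈ S', eval (cv t) F = 0 := fun t h => by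
    have h1 : (baseOpens ℂ n d).ι.base t.pt ∈ PrimeSpectrum.zeroLocus S' :=
      (ι_base_pt_mem_zeroLocus_iff ℂ n d t S').mpr fun F hF => by rw [hev t F]; exact h F hF
    have h2 : (baseOpens ℂ n d).ι.base t.pt ∈
        (↑(baseOpens ℂ n d) : Set (Spec (.of (CoeffRing ℂ n d))))ᶜ := by
      rw [hS']
      exact h1
    exact h2 (ι_base_pt_mem_baseOpens ℂ n d t)
  -- the two ideals and the locally closed set `V(I) ∖ V(J) = cv '' Z`
  set I : Ideal (CoeffRing ℂ n d) := Ideal.span S with hIdef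
  set J : Ideal (CoeffRing ℂ n d) := Ideal.span S' with hJdef
  have hzI : ∀ c : DegIndex n d → ℂ, c ∈ zeroLocus ℂ I ↔ ∀ F ∈ S, eval c F = 0 := fun c => by
    rw [hIdef, zeroLocus_span, Set.mem_setOf_eq]
    simp only [aeval_eq_eval]
  have hzJ : ∀ c : DegIndex n d → ℂ, c ∈ zeroLocus ℂ J ↔ ∀ F ∈ S', eval c F = 0 := fun c => by
    rw [hJdef, zeroLocus_span, Set.mem_setOf_eq]
    simp only [aeval_eq_eval]
  -- points from vectors off the discriminant
  have hlift : ∀ c : DegIndex n d → ℂ, c ∉ zeroLocus ℂ J →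
      ∃ t : AlgPoints (base ℂ n d) ℂ, cv t = c := fun c hc => by
    have hmem : PrimeSpectrum.comap (eval c) (IsLocalRing.closedPoint ℂ) ∈
        (baseOpens ℂ n d : Set (Spec (.of (CoeffRing ℂ n d)))) := by
      rw [hzJ] at hc
      by_contra hnot
      have hnot' : PrimeSpectrum.comap (eval c) (IsLocalRing.closedPoint ℂ) ∈
          (↑(baseOpens ℂ n d) : Set (Spec (.of (CoeffRing ℂ n d))))ᶜ := hnot
      rw [hS'] at hnot'
      exact hc ((comap_closedPoint_mem_zeroLocus_iff ℂ (eval c) S').mp hnot')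
    obtain ⟨t, ht⟩ := exists_point_of_comap_eval_mem_baseOpens ℂ n d c hmem
    refine ⟨t, funext fun m => ?_⟩
    change (pointHom ℂ n d t).hom (X m) = c m
    rw [ht, eval_X]
  have hC : zeroLocus ℂ I \ zeroLocus ℂ J = cv '' {P : AlgPoints (base ℂ n d) ℂ | P.pt ∈ Zc} := by
    ext c
    constructor
    · rintro ⟨hcI, hcJ⟩
      obtain ⟨t, rfl⟩ := hlift c hcJ
      exact ⟨t, (hmemZ t).mpr ((hzI _).mp hcI), rfl⟩
    · rintro ⟨t, ht, rfl⟩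
      exact ⟨(hzI _).mpr ((hmemZ t).mp ht), fun h => hnotD t ((hzJ _).mp h)⟩
  -- conjugation of coefficient vectors
  have hconj : ∀ (τ : ℂ ≃+* ℂ) (t : AlgPoints (base ℂ n d) ℂ),
      cv (pointOfForm ℂ n d ((isHomogeneous_pointForm ℂ n d t).map (τ : ℂ →+* ℂ))
        ((isNonsingularForm_pointForm ℂ n d t).map (τ : ℂ →+* ℂ))) = ⇑τ ∘ cv t :=
    fun τ t => funext fun m => pointHom_pointOfForm_map_apply_X ℂ n d (τ : ℂ →+* ℂ) t m
  -- stability of `V(I) ∖ V(J)`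
  have hstab' : ∀ τ : ℂ ≃+* ℂ, (∀ z : ℂ, IsAlgebraic ℚ z → τ z = z) →
      ∀ c ∈ zeroLocus ℂ I \ zeroLocus ℂ J, (⇑τ ∘ c) ∈ zeroLocus ℂ I \ zeroLocus ℂ J := by
    intro τ hτ c hc
    rw [hC] at hc ⊢
    obtain ⟨t, ht, rfl⟩ := hc
    exact ⟨_, hstab τ hτ t ht, hconj τ t⟩
  -- stability of `V(J)` (all automorphisms): its complement is the set of coefficient vectors
  have hcompl : ∀ c : DegIndex n d → ℂ,
      c ∉ zeroLocus ℂ J ↔ ∃ t : AlgPoints (base ℂ n d) ℂ, cv t = c :=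
    fun c => ⟨hlift c, fun ⟨t, ht⟩ h => hnotD t (ht ▸ (hzJ _).mp h)⟩
  have hJ' : ∀ τ : ℂ ≃+* ℂ, (∀ z : ℂ, IsAlgebraic ℚ z → τ z = z) →
      ∀ c ∈ zeroLocus ℂ J, (⇑τ ∘ c) ∈ zeroLocus ℂ J := by
    intro τ _ c hc
    by_contra hτc
    obtain ⟨t, ht⟩ := (hcompl _).mp hτc
    refine (hcompl c).mpr ⟨pointOfForm ℂ n d
      ((isHomogeneous_pointForm ℂ n d t).map (τ.symm : ℂ →+* ℂ))
      ((isNonsingularForm_pointForm ℂ n d t).map (τ.symm : ℂ →+* ℂ)), ?_⟩ hc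
    rw [hconj τ.symm t, ht]
    funext m
    simp
  -- the algebraic point
  have hne' : (zeroLocus ℂ I \ zeroLocus ℂ J).Nonempty := by
    rw [hC]
    exact hne.image cv
  obtain ⟨c₀, hc₀, halg⟩ :=
    Literature.FieldTheory.AlgClosed.Complex.exists_algebraic_point_of_forall_ringEquiv I J
      hstab' hJ' hne'
  rw [hC] at hc₀
  obtain ⟨t, ht, rfl⟩ := hc₀
  refine ⟨t, ht, fun m => ?_⟩
  by_cases hm : m.degree = d
  · rw [coeff_pointForm ℂ n d t ⟨m, hm⟩]
    exact halg ⟨m, hm⟩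
  · rw [(isHomogeneous_pointForm ℂ n d t).coeff_eq_zero hm]
    exact isAlgebraic_zero

end Complex

end Literature.AlgebraicGeometry.Motives.UniversalHypersurface

end
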